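import Summits.HodgeConjecture.HodgeConjecture.Theorems.CyclicUnitaryPowersThreeFacts
import Summits.HodgeConjecture.HodgeConjecture.Theorems.SignSymmetricPowersSevenFactsKernel
import Literature.AlgebraicGeometry.HodgeTheory.HypersurfaceEigenHodgeNumbersJacobianOfResidues

/-!
# The two K1 cruxes of the cell's F-H1 routes over ONE residue fact: `CyclicUnitaryPowers` K1 ⟸ {CT family,
# CDK, G5} and `SignSymmetricPowers` K1-B ⟸ {G5, ZvK, PL, GIC, D1, CDK, B2}, with G5 =
# `Griffiths1969_residues_primitive`

Cruxes `VeryGeneralDeckCommutatorsInHg` (stmt-HodgeConjecture-19544, route `CyclicUnitaryPowers`) and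
`VeryGeneralSignCommutatorsInHg` (stmt-HodgeConjecture-19716, route `SignSymmetricPowers`). Both routes read the
Hodge numbers of their hypersurfaces off Griffiths' residues; the tree now carries the residue theory as ONE named
fact with all clauses, `Literature.AlgebraicGeometry.HodgeTheory.Griffiths1969_residues_primitive` (G5: filtration,
span, equivariance, kernel, primitivity), which projects onto the kernel package G3
(`Griffiths1969_residueKernel_eq_jacobianIdeal_of_residues_primitive`) and from which Voisin's equivariant
eigen-Hodge numbers hV are DERIVED (`voisin2003_finrank_eigenspace_inf_hodgePiece_of_diagonalStabilizer_of_residues_primitive`,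
prover-Bx g6). This file restates the two conditional closings over G5:

* `veryGeneralDeckCommutatorsInHg_of_three_facts_primitive` — K1-A ⟸ {`nonempty_carlsonToledoFamily`,
  `cmsp_nonHodgeGenericPoints_countable_algebraic_cover`, G5} (`CyclicUnitaryPowersThreeFacts` ∘ projection);
* `veryGeneralSignCommutatorsInHg_of_seven_facts_primitive` — K1-B ⟸ {G5, ZvK, PL, GIC, D1, CDK, B2}
  (`SignSymmetricPowersSevenFactsKernel` ∘ projection);
(The registered binder `stub_voisinEigenHodgeNumbers` of K1-B (signature: hV) modulo G5 IS the Literature theorem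
`voisin2003_finrank_eigenspace_inf_hodgePiece_of_diagonalStabilizer_of_residues_primitive`; no restatement here.)

So the UNION of the two cruxes' cited inputs is {CT family, CDK, G5, ZvK, PL, GIC, D1, B2} — eight names.
CONDITIONAL results only; nothing here says HC ∕ HC_AV is proved; rung F-H1 not moved. Written by the prover seat
`hodge-nonav-prover-Bx` (g6).
-/

noncomputable section


set_option linter.dupNamespace false

namespace Summit.HodgeConjecture.HodgeConjecture.Theorems.FH1CruxesOfResiduesPrimitive

open Literature.AlgebraicGeometry.Motives Literature.AlgebraicGeometry.HodgeTheory

/-- **K1-A `VeryGeneralDeckCommutatorsInHg` ⟸ {CT family, CDK, G5}.** CONDITIONAL.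
[cite: CarlsonToledo1999, §2, §5 and §7 Theorem udensitytheo] [cite: VoisinHodgeII2003, §6.1.3 Thm. 6.10 and Cor. 6.12] -/
theorem veryGeneralDeckCommutatorsInHg_of_three_facts_primitive
    (hCT : nonempty_carlsonToledoFamily)
    (hCDK : cmsp_nonHodgeGenericPoints_countable_algebraic_cover)
    (hG5 : Griffiths1969_residues_primitive) :
    Summit.HodgeConjecture.HodgeConjecture.Theses.CyclicUnitaryPowers.VeryGeneralDeckCommutatorsInHg :=
  CyclicUnitaryPowersThreeFacts.veryGeneralDeckCommutatorsInHg_of_three_facts @hCT @hCDK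
    (Griffiths1969_residueKernel_eq_jacobianIdeal_of_residues_primitive hG5)

/-- **K1-B `VeryGeneralSignCommutatorsInHg` ⟸ {G5, ZvK, PL, GIC, D1, CDK, B2}.** CONDITIONAL.
[cite: VoisinHodgeII2003, §6.1.3 Thm. 6.10 and Cor. 6.12] -/
theorem veryGeneralSignCommutatorsInHg_of_seven_facts_primitive
    (hG5 : Griffiths1969_residues_primitive)
    (hZvK : Literature.AlgebraicGeometry.FundamentalGroup.affineHypersurfaceComplement_meridians_normalClosure_eq_top)
    (hPL : picardLefschetz_nodalForms_uniform)
    (hGIC : deligne_globalInvariantCycles)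
    (hD1 : discriminant_localBranches_nodal)
    (hCDK : cmsp_nonHodgeGenericPoints_countable_algebraic_cover)
    (hB2 : picardLefschetz_symmetricA3) :
    Summit.HodgeConjecture.HodgeConjecture.Theses.SignSymmetricPowers.VeryGeneralSignCommutatorsInHg :=
  SignSymmetricPowersSevenFactsKernel.veryGeneralSignCommutatorsInHg_of_seven_facts_kernel
    (Griffiths1969_residueKernel_eq_jacobianIdeal_of_residues_primitive hG5) @hZvK @hPL @hGIC @hD1 @hCDK @hB2

end Summit.HodgeConjecture.HodgeConjecture.Theorems.FH1CruxesOfResiduesPrimitive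

end
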